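import Mathlib
import Literature.Barriers.ValiantsHypothesis.AlgebraicNaturalProofs
import Literature.Computability.AlgebraicComplexity.ArithCircuitProofs
import Literature.Computability.AlgebraicComplexity.IMMInVPProofs
import Summits.ValiantsHypothesis.ValiantsHypothesis.Theorems.DivisionGapZeroOneTransferStubSqrtCheap
import HarnessLib

/-!
# Crux `BarrierLever.SuccinctHittingSetsForVP` (stmt-ValiantsHypothesis-14610), line `registered`
("level collapse by padding") — registered stub `stub_restrict`: PROJECTION–TRUNCATION OF SMALL
CIRCUITS

**Claim settled** (stub 2 of the lead's skeleton, TRUE and classical): over `ℂ`, for the tree's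
fan-in-two circuit size `L = complexity` (constants and variables free) and FSV's simple class
`SmallCircuits ℂ n b = {f : deg f ≤ n, L(f) ≤ n ^ b}` in `n` variables, for every size exponent `b`
there are `b' = b + 8` and `n₀ = 3 ^ b + 4` such that for `n₀ ≤ n ≤ n' ≤ 3n` every
`f' ∈ SmallCircuits ℂ n' b` has a SHADOW `f ∈ SmallCircuits ℂ n b'` with the same coefficient at
every monomial `m` in `x₀ … x_{n-1}` of degree `≤ n` (identified with its zero-padding
`m.mapDomain (Fin.castLE h)`).

Proof.  (1) Kill the variables beyond `n`: `g := killCompl (Fin.castLE h) f'`, i.e. the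
substitution `x_i ↦ x_i` (`i < n`), `x_i ↦ 0` (`i ≥ n`); `coeff m g = coeff (pad m) f'`
(`MvPolynomial.coeff_killCompl`), `deg g ≤ deg f'`, and `L(g) ≤ L(f')` by the substitution bound
`complexity_aeval_le` (every substituted value is a variable or the constant `0`, both free).
(2) Cut the degree: `f := Σ_{i ≤ n} g_i` (homogeneous components); `coeff m f = coeff m g` for
`deg m ≤ n`, `deg f ≤ n`, and HOMOGENEOUS COMPONENTS ARE CHEAP
(`SqrtCheap.complexity_homogeneousComponent_le`, interpolation at `n' + 1` scalings):
`L(f) ≤ (n+1)·((n'+1)·(L(g) + n + 2)) + (n+1)`.  (3) Arithmetic: with `L(g) ≤ n'^b ≤ (3n)^b ≤ n^(b+1)`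
(`3^b ≤ n`) the bound is `≤ n^(b+8)` for `n ≥ 4` (`final_arith`).

Unconditional (axioms `propext`, `Classical.choice`, `Quot.sound`). References: [Burgisser2000]
Def. 2.1, Rem. 2.7 (substitution); extraction of homogeneous components by interpolation is
folklore (Strassen 1973; [BurgisserClausenShokrollahi1997] (21.27)).
-/

-- layout Summits/ValiantsHypothesis/ValiantsHypothesis forces the duplicated namespace component
set_option linter.dupNamespace false

namespace Summit.ValiantsHypothesis.ValiantsHypothesis.Theorems.BarrierLever.SuccinctHittingSetsForVP

open Literature.Barriers.ValiantsHypothesis Literature.Computability.AlgebraicComplexity MvPolynomial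
open Summit.ValiantsHypothesis.ValiantsHypothesis.Theorems.DivisionGapZeroOneTransfer.SqrtCheap

namespace StubRestrict

/-- **Killing variables is free.** For `n ≤ n'` and `f'` in the variables `x₀ … x_{n'-1}`, the
substitution `x_i ↦ 0` (`i ≥ n`) yields `g` in `x₀ … x_{n-1}` with `L(g) ≤ L(f')`,
`deg g ≤ deg f'`, and `coeff m g = coeff (pad m) f'` for every exponent vector `m`
(`MvPolynomial.killCompl`, `coeff_killCompl`; cost by the substitution bound, constants and
variables being free). [cite: Burgisser2000, Rem. 2.7] -/
theorem exists_kill {n n' : ℕ} (h : n ≤ n') (f' : MvPolynomial (Fin n') ℂ) :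
    ∃ g : MvPolynomial (Fin n) ℂ, complexity g ≤ complexity f' ∧
      g.totalDegree ≤ f'.totalDegree ∧
      ∀ m : Fin n →₀ ℕ, coeff m g = coeff (m.mapDomain (Fin.castLE h)) f' := by
  refine ⟨killCompl (Fin.castLE_injective h) f', ?_, ?_, fun m => coeff_killCompl _⟩
  · rw [killCompl]
    refine (complexity_aeval_le f' _).trans (le_of_eq ?_)
    rw [Finset.sum_eq_zero, add_zero]
    intro i _
    split_ifs
    · exact complexity_X_holds _
    · exact complexity_zero_eq
  · refine Finset.sup_le fun x hx => ?_
    rw [support_killCompl, Finset.mem_preimage] at hx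
    exact (Finsupp.sum_mapDomain_index (fun _ => rfl) (fun _ _ _ => rfl)).symm.trans_le
      (le_totalDegree hx)

/-- **Degree truncation is cheap.** If `deg g ≤ d` then `f := Σ_{i ≤ e} g_i` (homogeneous
components) has `deg f ≤ e`, the same coefficients as `g` at all monomials of degree `≤ e`, and
`L(f) ≤ (e+1)·((d+1)·(L(g) + n + 2)) + (e+1)` (each component by interpolation,
`SqrtCheap.complexity_homogeneousComponent_le`, summed without sharing). [folklore] -/
theorem exists_truncate {n d : ℕ} (g : MvPolynomial (Fin n) ℂ) (hd : g.totalDegree ≤ d) (e : ℕ) :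
    ∃ f : MvPolynomial (Fin n) ℂ, f.totalDegree ≤ e ∧
      complexity f ≤ (e + 1) * ((d + 1) * (complexity g + n + 2)) + (e + 1) ∧
      ∀ m : Fin n →₀ ℕ, m.degree ≤ e → coeff m f = coeff m g := by
  refine ⟨∑ i ∈ Finset.range (e + 1), homogeneousComponent i g, ?_, ?_, fun m hm => ?_⟩
  · refine totalDegree_finsetSum_le fun i hi => ?_
    have hi' : i ≤ e := by have := Finset.mem_range.mp hi; omega
    exact (homogeneousComponent_isHomogeneous i g).totalDegree_le.trans hi'
  · calc complexity (∑ i ∈ Finset.range (e + 1), homogeneousComponent i g)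
        ≤ ∑ i ∈ Finset.range (e + 1), complexity (homogeneousComponent i g) +
            (Finset.range (e + 1)).card := complexity_finset_sum_le _ _
      _ ≤ ∑ i ∈ Finset.range (e + 1), (d + 1) * (complexity g + n + 2) +
            (Finset.range (e + 1)).card := by
          gcongr with i hi
          simpa only [Fintype.card_fin] using complexity_homogeneousComponent_le g hd i
      _ = (e + 1) * ((d + 1) * (complexity g + n + 2)) + (e + 1) := by
          rw [Finset.sum_const, Finset.card_range, smul_eq_mul]
  · rw [coeff_sum, Finset.sum_eq_single_of_mem m.degree (Finset.mem_range.mpr (by omega))]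
    · rw [coeff_homogeneousComponent, if_pos rfl]
    · intro i _ hi
      rw [coeff_homogeneousComponent, if_neg (Ne.symm hi)]

/-- The final arithmetic: for `n ≥ 3 ^ b + 4`, `n' ≤ 3n` and `c ≤ n'^b` (so
`c ≤ (3n)^b = 3^b n^b ≤ n^(b+1)`), `(n+1)·((n'+1)·(c + n + 2)) + (n+1) ≤ n²·n²·n^(b+3) + n² ≤ n^(b+8)`.
[folklore] -/
theorem final_arith (b n n' c : ℕ) (hn : 3 ^ b + 4 ≤ n) (hn' : n' ≤ 3 * n) (hc : c ≤ n' ^ b) :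
    (n + 1) * ((n' + 1) * (c + n + 2)) + (n + 1) ≤ n ^ (b + 8) := by
  have h4 : 4 ≤ n := le_trans (Nat.le_add_left 4 (3 ^ b)) hn
  have h3b : 3 ^ b ≤ n := le_trans (Nat.le_add_right (3 ^ b) 4) hn
  have h1 : n + 1 ≤ n ^ 2 := by nlinarith
  have h2 : n' + 1 ≤ n ^ 2 := by nlinarith
  have hc' : c ≤ n ^ (b + 1) := by
    calc c ≤ n' ^ b := hc
      _ ≤ (3 * n) ^ b := Nat.pow_le_pow_left hn' _
      _ = 3 ^ b * n ^ b := by rw [mul_pow]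
      _ ≤ n * n ^ b := Nat.mul_le_mul_right _ h3b
      _ = n ^ (b + 1) := by ring
  have h3 : c + n + 2 ≤ n ^ (b + 3) := by
    have hn2 : n + 2 ≤ n ^ 2 := by nlinarith
    have hp1 : n ^ (b + 1) ≤ n ^ (b + 2) := Nat.pow_le_pow_right (by omega) (by omega)
    have hp2 : n ^ 2 ≤ n ^ (b + 2) := Nat.pow_le_pow_right (by omega) (by omega)
    calc c + n + 2 ≤ n ^ (b + 2) + n ^ (b + 2) := by omega
      _ = n ^ (b + 2) * 2 := by ring
      _ ≤ n ^ (b + 2) * n := Nat.mul_le_mul_left _ (by omega)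
      _ = n ^ (b + 3) := by ring
  have h5 : n ^ 2 ≤ n ^ (b + 7) := Nat.pow_le_pow_right (by omega) (by omega)
  calc (n + 1) * ((n' + 1) * (c + n + 2)) + (n + 1)
      ≤ n ^ 2 * (n ^ 2 * n ^ (b + 3)) + n ^ 2 := by gcongr
    _ ≤ n ^ (b + 7) + n ^ (b + 7) := by
        have e : n ^ 2 * (n ^ 2 * n ^ (b + 3)) = n ^ (b + 7) := by ring
        omega
    _ = n ^ (b + 7) * 2 := by ring
    _ ≤ n ^ (b + 7) * n := Nat.mul_le_mul_left _ (by omega)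
    _ = n ^ (b + 8) := by ring

end StubRestrict

/-- **Registered stub `stub_restrict`** (crux stmt-ValiantsHypothesis-14610, line `registered`
"level collapse by padding", stub 2 of the skeleton): PROJECTION–TRUNCATION OF SMALL CIRCUITS.
For every size exponent `b` there are `b' (= b + 8)` and `n₀ (= 3 ^ b + 4)` such that for
`n₀ ≤ n ≤ n' ≤ 3n` every `f' ∈ SmallCircuits ℂ n' b` (degree `≤ n'`, size `≤ n'^b`, `n'` variables)
has a shadow `f ∈ SmallCircuits ℂ n b'` (degree `≤ n`, size `≤ n^b'`, the first `n` variables)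
with `coeff m f = coeff (m.mapDomain (Fin.castLE h)) f'` for every `m` of degree `≤ n`: kill the
variables `x_n, …, x_{n'-1}` (`StubRestrict.exists_kill`, free by the substitution bound), then keep
the homogeneous components of degree `≤ n` (`StubRestrict.exists_truncate`, interpolation).
[cite: Burgisser2000, Rem. 2.7] -/
theorem stub_restrict :
    ∀ b : ℕ, ∃ b' n₀ : ℕ, ∀ n : ℕ, n₀ ≤ n → ∀ (n' : ℕ) (h : n ≤ n'), n' ≤ 3 * n →
      ∀ f' ∈ SmallCircuits ℂ n' b, ∃ f ∈ SmallCircuits ℂ n b',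
        ∀ m : Fin n →₀ ℕ, m.degree ≤ n →
          MvPolynomial.coeff m f = MvPolynomial.coeff (m.mapDomain (Fin.castLE h)) f' := by
  intro b
  refine ⟨b + 8, 3 ^ b + 4, fun n hn n' h hn' f' hf' => ?_⟩
  obtain ⟨g, hgc, hgd, hgm⟩ := StubRestrict.exists_kill h f'
  obtain ⟨f, hfd, hfc, hfm⟩ := StubRestrict.exists_truncate g (hgd.trans hf'.1) n
  refine ⟨f, ⟨hfd, ?_⟩, fun m hm => (hfm m hm).trans (hgm m)⟩
  exact hfc.trans (StubRestrict.final_arith b n n' _ hn hn' (hgc.trans hf'.2))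

end Summit.ValiantsHypothesis.ValiantsHypothesis.Theorems.BarrierLever.SuccinctHittingSetsForVP
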